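import Literature.Geometry.Lorentzian.SpacetimeLocalConvergenceTimeOrientation
import Literature.Geometry.Lorentzian.Isometry
import HarnessLib

/-!
# Pointed `Cᵏ_loc` limits are invariant under time-oriented isometries of the limit
(topic `Geometry/Lorentzian`; `Spacetime.LocalSubconvergence.isometryPullback`,
`Spacetime.SubconvergesLocallyTo.of_isometry` — limits of spacetimes are defined up to isometry;
Petersen 2006, Ch. 10, §3.2; O'Neill 1983, Ch. 3, Def. 3.4 and Ch. 5, p. 145)

Let `D : (𝓢ₙ, pₙ) ⇀ (𝓣, t)` be a pointed `Cᵏ_loc` subconvergence datum and let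
`Φ : 𝓣' ≅ 𝓣` be a diffeomorphism which is an ISOMETRY (`Φ^* g = g'`) and PRESERVES THE TIME
ORIENTATIONS (`dΦ T'` is future-directed). Then `(𝓢ₙ, pₙ) ⇀ (𝓣', Φ⁻¹ t)`: exhaustion
`Φ⁻¹(U (ρ m))`-style (we keep `Φ⁻¹(U m)`), comparison maps `φ_{ρ m} ∘ Φ` for a strictly increasing
re-indexing `ρ` (needed because `φₙ` is only asked to preserve the orientation of the field `T` of
`𝓣`, while `dΦ T' ≠ T` in general — its images are future-directed only eventually, by the margin
argument `eventually_isFutureDirected_mfderiv_comp`), and convergence from the first-bracket lemma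
`tendsto_supCkENorm_comp_sub` with `F = Φ` together with `(Φ ∘ c'⁻¹)^* g = c'⁻¹^* g'`.

Consequently hull / limit-set notions phrased through `SubconvergesLocallyTo` are invariant under
time-oriented isometries of the limit (`SubconvergesLocallyTo.of_isometry`), as they must be for
"the limit is (isometric to) Kerr" statements.

## References
* [Petersen2006] P. Petersen, *Riemannian Geometry*, 2nd ed., GTM 171, Springer 2006, Ch. 10, §3.2.
* [ONeill1983] B. O'Neill, *Semi-Riemannian Geometry*, Academic Press 1983, Ch. 3, Def. 3.4; Ch. 5, p. 145.
-/

noncomputable section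

open TopologicalSpace Manifold Filter Topology Set Function Metric Bundle
open scoped ContDiff Topology ENNReal

universe u v w

namespace Literature.Geometry.Lorentzian

namespace Spacetime

namespace LocalSubconvergence

variable {𝓢ₙ : ℕ → Spacetime.{u} 4} {pₙ : ∀ n, (𝓢ₙ n).carrier} {𝓣 : Spacetime.{v} 4}
  {t : 𝓣.carrier} {k : ℕ} {𝓣' : Spacetime.{w} 4}

section Isometry

variable (D : LocalSubconvergence 𝓢ₙ pₙ 𝓣 t k)
  (Φ : Diffeomorph (𝓡 4) (𝓡 4) 𝓣'.carrier 𝓣.carrier ∞)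

/-- Abbreviation for the hypothesis "`Φ` is an isometry `𝓣' → 𝓣`". [cite: ONeill1983, Ch. 3, Def. 3.4] -/
abbrev IsSpacetimeIsometry (Φ : Diffeomorph (𝓡 4) (𝓡 4) 𝓣'.carrier 𝓣.carrier ∞) : Prop :=
  PseudoRiemannianMetric.IsIsometry 𝓣'.metric.toPseudoRiemannianMetric
    𝓣.metric.toPseudoRiemannianMetric Φ

/-- Abbreviation for the hypothesis "`Φ` preserves the time orientations". [cite: ONeill1983, Ch. 5, p. 145] -/
abbrev IsTimeOriented (Φ : Diffeomorph (𝓡 4) (𝓡 4) 𝓣'.carrier 𝓣.carrier ∞) : Prop :=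
  TimeOrientation.PreservesTimeOrientation Φ 𝓣'.timeOrientation 𝓣.timeOrientation

/-- The pulled-back exhausting sets `Φ⁻¹(U m)`. [folklore] -/
def isoOpens (m : ℕ) : Opens 𝓣'.carrier := ⟨Φ ⁻¹' (D.U m : Set 𝓣.carrier), (D.U m).isOpen.preimage Φ.continuous⟩

/-- Membership in the pulled-back sets. [folklore] -/
theorem mem_isoOpens {m : ℕ} {x : 𝓣'.carrier} : x ∈ D.isoOpens Φ m ↔ Φ x ∈ D.U m := Iff.rfl

/-- The pulled-back sets are increasing. [folklore] -/
theorem monotone_isoOpens : Monotone (D.isoOpens Φ) := fun _ _ h _ hx ↦ D.monotone_U h hx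

/-- The closure of a pulled-back set is compact (it is the preimage of the compact closure under the
homeomorphism `Φ`). [folklore] -/
theorem isCompact_closure_isoOpens (m : ℕ) :
    IsCompact (closure (D.isoOpens Φ m : Set 𝓣'.carrier)) := by
  have h : closure (D.isoOpens Φ m : Set 𝓣'.carrier) = Φ.toHomeomorph ⁻¹' closure (D.U m) := by
    rw [Φ.toHomeomorph.preimage_closure]
    rfl
  rw [h, ← Φ.toHomeomorph.image_symm]
  exact (D.isCompact_closure_U m).image Φ.toHomeomorph.symm.continuous

/-- `dΦ` sends the orienting field of `𝓣'` to TIMELIKE vectors (an isometry preserves causal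
characters). [cite: ONeill1983, Ch. 3, Def. 3.4] -/
theorem isTimelike_mfderiv_iso (hΦ : IsSpacetimeIsometry (𝓣 := 𝓣) (𝓣' := 𝓣') Φ) (x : 𝓣'.carrier) :
    𝓣.metric.IsTimelike (mfderiv (𝓡 4) (𝓡 4) Φ x (𝓣'.timeOrientation.vectorField x)) := by
  have h := hΦ x
  have happ := congrArg (fun B ↦ B (𝓣'.timeOrientation.vectorField x)
    (𝓣'.timeOrientation.vectorField x)) h
  simp only [pullbackBilin_apply] at happ
  show 𝓣.metric.val (Φ x) _ _ < 0
  rw [show 𝓣.metric.val = 𝓣.metric.toPseudoRiemannianMetric.val from rfl, happ]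
  exact 𝓣'.timeOrientation.isTimelike x

/-- **The re-indexing requirements** at stage `m`: `m ≤ n` and `d(φₙ ∘ Φ)` preserves the time
orientation on the closure of `Φ⁻¹(U m)`. They hold for all large `n`. [cite: Petersen2006, Ch. 10 §3.2] -/
theorem eventually_isoGood (hΦ : IsSpacetimeIsometry (𝓣 := 𝓣) (𝓣' := 𝓣') Φ)
    (hor : IsTimeOriented (𝓣 := 𝓣) (𝓣' := 𝓣') Φ) (m : ℕ) : ∀ᶠ n in atTop, m ≤ n ∧
    ∀ x ∈ closure (D.isoOpens Φ m : Set 𝓣'.carrier),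
      (𝓢ₙ (D.sub n)).timeOrientation.IsFutureDirected
        (mfderiv (𝓡 4) (𝓡 4) (D.embed n ∘ Φ) x (𝓣'.timeOrientation.vectorField x)) :=
  (eventually_ge_atTop m).and
    (D.eventually_isFutureDirected_mfderiv_comp isOpen_univ Φ.contMDiff.contMDiffOn
      (D.isCompact_closure_isoOpens Φ m) (subset_univ _) (fun x _ ↦ hor x)
      (fun x _ ↦ isTimelike_mfderiv_iso Φ hΦ x))

/-- Existence of the re-indexing. [folklore] -/
theorem exists_isoIndex (hΦ : IsSpacetimeIsometry (𝓣 := 𝓣) (𝓣' := 𝓣') Φ) (hor : IsTimeOriented (𝓣 := 𝓣) (𝓣' := 𝓣') Φ) :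
    ∃ ρ : ℕ → ℕ, StrictMono ρ ∧ ∀ m, m ≤ ρ m ∧
    ∀ x ∈ closure (D.isoOpens Φ m : Set 𝓣'.carrier),
      (𝓢ₙ (D.sub (ρ m))).timeOrientation.IsFutureDirected
        (mfderiv (𝓡 4) (𝓡 4) (D.embed (ρ m) ∘ Φ) x (𝓣'.timeOrientation.vectorField x)) :=
  extraction_forall_of_eventually fun m ↦ D.eventually_isoGood Φ hΦ hor m

/-- The re-indexing (a choice). [folklore] -/
def isoIndex (hΦ : IsSpacetimeIsometry (𝓣 := 𝓣) (𝓣' := 𝓣') Φ) (hor : IsTimeOriented (𝓣 := 𝓣) (𝓣' := 𝓣') Φ) : ℕ → ℕ :=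
  Classical.choose (D.exists_isoIndex Φ hΦ hor)

/-- The re-indexing is strictly increasing. [folklore] -/
theorem strictMono_isoIndex (hΦ : IsSpacetimeIsometry (𝓣 := 𝓣) (𝓣' := 𝓣') Φ) (hor : IsTimeOriented (𝓣 := 𝓣) (𝓣' := 𝓣') Φ) :
    StrictMono (D.isoIndex Φ hΦ hor) :=
  (Classical.choose_spec (D.exists_isoIndex Φ hΦ hor)).1

/-- The defining properties of the re-indexing. [folklore] -/
theorem isoIndex_spec (hΦ : IsSpacetimeIsometry (𝓣 := 𝓣) (𝓣' := 𝓣') Φ) (hor : IsTimeOriented (𝓣 := 𝓣) (𝓣' := 𝓣') Φ) (m : ℕ) :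
    m ≤ D.isoIndex Φ hΦ hor m ∧
    ∀ x ∈ closure (D.isoOpens Φ m : Set 𝓣'.carrier),
      (𝓢ₙ (D.sub (D.isoIndex Φ hΦ hor m))).timeOrientation.IsFutureDirected
        (mfderiv (𝓡 4) (𝓡 4) (D.embed (D.isoIndex Φ hΦ hor m) ∘ Φ) x
          (𝓣'.timeOrientation.vectorField x)) :=
  (Classical.choose_spec (D.exists_isoIndex Φ hΦ hor)).2 m

/-- **Identification of the reference term**: `(Φ ∘ c'⁻¹)^* g = c'⁻¹^* g'` on the chart target
(the isometry read in a chart of `𝓣'`). [cite: ONeill1983, Ch. 3, Def. 3.4] -/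
theorem metricInCoords_iso_comp (hΦ : IsSpacetimeIsometry (𝓣 := 𝓣) (𝓣' := 𝓣') Φ) (x' : 𝓣'.carrier) {y : E4}
    (hy : y ∈ (chartAt E4 x').target) :
    𝓣.metricInCoords (Φ ∘ (chartAt E4 x').symm) y = 𝓣'.metricInCoords (chartAt E4 x').symm y := by
  have hψ : MDifferentiableAt 𝓘(ℝ, E4) (𝓡 4) (chartAt E4 x').symm y :=
    ((contMDiffOn_chart_symm (x := x') (n := 1) y hy).mdifferentiableWithinAt one_ne_zero)
      |>.mdifferentiableAt ((chartAt E4 x').open_target.mem_nhds hy)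
  have hΦd : MDifferentiableAt (𝓡 4) (𝓡 4) Φ ((chartAt E4 x').symm y) :=
    Φ.contMDiff.mdifferentiableAt (by simp)
  show pullbackBilin (I := 𝓡 4) (I' := 𝓘(ℝ, E4)) (Φ ∘ (chartAt E4 x').symm) 𝓣.metric.val y =
    pullbackBilin (I := 𝓡 4) (I' := 𝓘(ℝ, E4)) (chartAt E4 x').symm 𝓣'.metric.val y
  ext v w
  simp only [pullbackBilin_apply, Function.comp_apply]
  rw [mfderiv_comp y hΦd hψ]
  have h := congrArg (fun B ↦ B (mfderiv 𝓘(ℝ, E4) (𝓡 4) (chartAt E4 x').symm y v)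
    (mfderiv 𝓘(ℝ, E4) (𝓡 4) (chartAt E4 x').symm y w)) (hΦ ((chartAt E4 x').symm y))
  simp only [pullbackBilin_apply] at h
  exact h

/-- **The isometric pull-back of a datum**: `(𝓢ₙ, pₙ) ⇀ (𝓣', Φ⁻¹ t)` with exhaustion `Φ⁻¹(U m)`
and comparison maps `φ_{ρ m} ∘ Φ`. [cite: Petersen2006, Ch. 10 §3.2] -/
def isometryPullback (hΦ : IsSpacetimeIsometry (𝓣 := 𝓣) (𝓣' := 𝓣') Φ) (hor : IsTimeOriented (𝓣 := 𝓣) (𝓣' := 𝓣') Φ) :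
    LocalSubconvergence 𝓢ₙ pₙ 𝓣' (Φ.symm t) k where
  sub := D.sub ∘ D.isoIndex Φ hΦ hor
  strictMono_sub := D.strictMono_sub.comp (D.strictMono_isoIndex Φ hΦ hor)
  U := D.isoOpens Φ
  monotone_U := D.monotone_isoOpens Φ
  mem_U := by
    show Φ (Φ.symm t) ∈ D.U 0
    rw [Diffeomorph.apply_symm_apply]
    exact D.mem_U
  iUnion_U := by
    refine eq_univ_of_forall fun x ↦ ?_
    have hx : Φ x ∈ ⋃ n, (D.U n : Set 𝓣.carrier) := D.iUnion_U.symm ▸ mem_univ _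
    obtain ⟨n, hn⟩ := mem_iUnion.1 hx
    exact mem_iUnion.2 ⟨n, hn⟩
  isCompact_closure_U := D.isCompact_closure_isoOpens Φ
  embed m := D.embed (D.isoIndex Φ hΦ hor m) ∘ Φ
  isLocalDiffeomorphOn_embed m :=
    isLocalDiffeomorphOn_comp (D.isLocalDiffeomorphOn_embed _)
      (Φ.isLocalDiffeomorph.isLocalDiffeomorphOn _)
      fun x hx ↦ D.monotone_U (D.isoIndex_spec Φ hΦ hor m).1 hx
  injOn_embed m := (D.injOn_embed _).comp Φ.injective.injOn
    fun x hx ↦ D.monotone_U (D.isoIndex_spec Φ hΦ hor m).1 hx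
  embed_basepoint m := by
    show D.embed _ (Φ (Φ.symm t)) = _
    rw [Diffeomorph.apply_symm_apply]
    exact D.embed_basepoint _
  isFutureDirected_mfderiv_embed m x hx := (D.isoIndex_spec Φ hΦ hor m).2 x (subset_closure hx)
  tendsto_supCkENorm x' K hK hKt := by
    have h := (D.tendsto_supCkENorm_comp_sub isOpen_univ Φ.contMDiff.contMDiffOn x' hK hKt
      (mapsTo_univ _ _)).comp (D.strictMono_isoIndex Φ hΦ hor).tendsto_atTop
    have heq : ∀ n : ℕ,
        supCkENorm K k ((𝓢ₙ (D.sub n)).metricInCoords ((D.embed n ∘ Φ) ∘ (chartAt E4 x').symm) -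
            𝓣.metricInCoords (Φ ∘ (chartAt E4 x').symm)) =
          supCkENorm K k ((𝓢ₙ (D.sub n)).metricInCoords ((D.embed n ∘ Φ) ∘ (chartAt E4 x').symm) -
            𝓣'.metricInCoords (chartAt E4 x').symm) := fun n ↦ by
      refine supCkENorm_congr fun y hy ↦ ?_
      filter_upwards [(chartAt E4 x').open_target.mem_nhds (hKt hy)] with z hz
      simp only [Pi.sub_apply]
      rw [metricInCoords_iso_comp Φ hΦ x' hz]
    exact h.congr fun m ↦ heq _

end Isometry

/-! ### Isometries of the SOURCE spacetimes -/

section Source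

variable {𝓢'ₙ : ℕ → Spacetime.{w} 4} (D : LocalSubconvergence 𝓢ₙ pₙ 𝓣 t k)
  (Ψ : ∀ n, Diffeomorph (𝓡 4) (𝓡 4) (𝓢ₙ n).carrier (𝓢'ₙ n).carrier ∞)

/-- **Pushing a datum forward along time-oriented isometries of the source spacetimes.** If
`(𝓢ₙ, pₙ) ⇀ (𝓣, t)` and `Ψₙ : 𝓢ₙ ≅ 𝓢'ₙ` are isometries preserving the time orientations, then
`(𝓢'ₙ, Ψₙ pₙ) ⇀ (𝓣, t)` with the same exhaustion and the comparison maps `Ψ_{sub n} ∘ φₙ`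
(the pulled-back metrics are literally the same: `φₙ^* Ψₙ^* g'ₙ = φₙ^* gₙ`). [cite: Petersen2006, Ch. 10 §3.2] -/
def isometryPushforward
    (hΨ : ∀ n, PseudoRiemannianMetric.IsIsometry (𝓢ₙ n).metric.toPseudoRiemannianMetric
      (𝓢'ₙ n).metric.toPseudoRiemannianMetric (Ψ n))
    (hor : ∀ n, TimeOrientation.PreservesTimeOrientation (Ψ n) (𝓢ₙ n).timeOrientation
      (𝓢'ₙ n).timeOrientation) :
    LocalSubconvergence 𝓢'ₙ (fun n ↦ Ψ n (pₙ n)) 𝓣 t k where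
  sub := D.sub
  strictMono_sub := D.strictMono_sub
  U := D.U
  monotone_U := D.monotone_U
  mem_U := D.mem_U
  iUnion_U := D.iUnion_U
  isCompact_closure_U := D.isCompact_closure_U
  embed n := Ψ (D.sub n) ∘ D.embed n
  isLocalDiffeomorphOn_embed n :=
    isLocalDiffeomorphOn_comp ((Ψ (D.sub n)).isLocalDiffeomorph.isLocalDiffeomorphOn univ)
      (D.isLocalDiffeomorphOn_embed n) (mapsTo_univ _ _)
  injOn_embed n := (Ψ (D.sub n)).injective.injOn.comp (D.injOn_embed n) (mapsTo_univ _ _)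
  embed_basepoint n := by
    show Ψ (D.sub n) (D.embed n t) = _
    rw [D.embed_basepoint]
  isFutureDirected_mfderiv_embed n x hx := by
    have hG : MDifferentiableAt (𝓡 4) (𝓡 4) (D.embed n) x :=
      ((D.contMDiffOn_embed n x hx).contMDiffAt ((D.U n).isOpen.mem_nhds hx)).mdifferentiableAt
        (by simp)
    rw [mfderiv_comp x ((Ψ (D.sub n)).contMDiff.mdifferentiableAt (by simp)) hG]
    exact TimeOrientation.PreservesTimeOrientation.isFutureDirected_mfderiv (hor (D.sub n))
      (hΨ (D.sub n)) (D.isFutureDirected_mfderiv_embed n x hx)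
  tendsto_supCkENorm x' K hK hKt := by
    set c := chartAt E4 x' with hc
    -- an open neighbourhood `V` of `K` in the chart target whose pull-back is compactly inside `𝓣`
    have hKc : IsCompact (c.symm '' K) := hK.image_of_continuousOn (c.continuousOn_symm.mono hKt)
    have hev : ∀ᶠ n in atTop, c.symm '' K ⊆ D.U n := D.eventually_subset_U hKc
    refine (D.tendsto_supCkENorm x' K hK hKt).congr' ?_
    filter_upwards [hev] with n hn
    refine supCkENorm_congr fun y hy ↦ ?_
    -- near `y`, both deviations agree: `(Ψ ∘ φ ∘ c⁻¹)^* g' = (φ ∘ c⁻¹)^* g` where `φ ∘ c⁻¹` is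
    -- differentiable, i.e. on the open set `c.target ∩ c.symm ⁻¹' U n ∋ y`
    have hWo : IsOpen (c.target ∩ c.symm ⁻¹' (D.U n : Set 𝓣.carrier)) :=
      c.continuousOn_symm.isOpen_inter_preimage c.open_target (D.U n).isOpen
    have hyW : y ∈ c.target ∩ c.symm ⁻¹' (D.U n : Set 𝓣.carrier) :=
      ⟨hKt hy, hn (mem_image_of_mem _ hy)⟩
    filter_upwards [hWo.mem_nhds hyW] with z hz
    simp only [Pi.sub_apply]
    congr 1
    have hψ : MDifferentiableAt 𝓘(ℝ, E4) (𝓡 4) c.symm z :=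
      ((contMDiffOn_chart_symm (x := x') (n := 1) z hz.1).mdifferentiableWithinAt one_ne_zero)
        |>.mdifferentiableAt (c.open_target.mem_nhds hz.1)
    have hφ : MDifferentiableAt (𝓡 4) (𝓡 4) (D.embed n) (c.symm z) :=
      ((D.contMDiffOn_embed n _ hz.2).contMDiffAt ((D.U n).isOpen.mem_nhds hz.2)).mdifferentiableAt
        (by simp)
    have hcomp : MDifferentiableAt 𝓘(ℝ, E4) (𝓡 4) (D.embed n ∘ c.symm) z := hφ.comp z hψ
    have hΨd : MDifferentiableAt (𝓡 4) (𝓡 4) (Ψ (D.sub n)) ((D.embed n ∘ c.symm) z) :=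
      (Ψ (D.sub n)).contMDiff.mdifferentiableAt (by simp)
    symm
    show pullbackBilin (I := 𝓡 4) (I' := 𝓘(ℝ, E4)) ((Ψ (D.sub n) ∘ D.embed n) ∘ c.symm)
        (𝓢'ₙ (D.sub n)).metric.val z =
      pullbackBilin (I := 𝓡 4) (I' := 𝓘(ℝ, E4)) (D.embed n ∘ c.symm) (𝓢ₙ (D.sub n)).metric.val z
    rw [show ((Ψ (D.sub n) ∘ D.embed n) ∘ c.symm) = Ψ (D.sub n) ∘ (D.embed n ∘ c.symm) from rfl]
    ext v w
    simp only [pullbackBilin_apply, Function.comp_apply]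
    rw [mfderiv_comp z hΨd hcomp]
    have h := congrArg (fun B ↦ B (mfderiv 𝓘(ℝ, E4) (𝓡 4) (D.embed n ∘ c.symm) z v)
      (mfderiv 𝓘(ℝ, E4) (𝓡 4) (D.embed n ∘ c.symm) z w)) (hΨ (D.sub n) ((D.embed n ∘ c.symm) z))
    simp only [pullbackBilin_apply] at h
    exact h

end Source

end LocalSubconvergence

/-- **Pointed `Cᵏ_loc` limits are invariant under time-oriented isometries of the limit**: if
`(𝓢ₙ, pₙ) ⇀ (𝓣, t)` and `Φ : 𝓣' ≅ 𝓣` is an isometry preserving the time orientations, then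
`(𝓢ₙ, pₙ) ⇀ (𝓣', Φ⁻¹ t)`. [cite: Petersen2006, Ch. 10 §3.2] -/
theorem SubconvergesLocallyTo.of_isometry {𝓢ₙ : ℕ → Spacetime.{u} 4} {pₙ : ∀ n, (𝓢ₙ n).carrier}
    {𝓣 : Spacetime.{v} 4} {t : 𝓣.carrier} {k : ℕ} {𝓣' : Spacetime.{w} 4}
    (h : SubconvergesLocallyTo 𝓢ₙ pₙ 𝓣 t k)
    (Φ : Diffeomorph (𝓡 4) (𝓡 4) 𝓣'.carrier 𝓣.carrier ∞)
    (hΦ : LocalSubconvergence.IsSpacetimeIsometry (𝓣 := 𝓣) (𝓣' := 𝓣') Φ)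
    (hor : LocalSubconvergence.IsTimeOriented (𝓣 := 𝓣) (𝓣' := 𝓣') Φ) :
    SubconvergesLocallyTo 𝓢ₙ pₙ 𝓣' (Φ.symm t) k := by
  obtain ⟨D⟩ := h
  exact ⟨D.isometryPullback Φ hΦ hor⟩

/-- **Pointed `Cᵏ_loc` limits are invariant under time-oriented isometries of the sources**: if
`(𝓢ₙ, pₙ) ⇀ (𝓣, t)` and `Ψₙ : 𝓢ₙ ≅ 𝓢'ₙ` are isometries preserving the time orientations, then
`(𝓢'ₙ, Ψₙ pₙ) ⇀ (𝓣, t)`. [cite: Petersen2006, Ch. 10 §3.2] -/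
theorem SubconvergesLocallyTo.of_source_isometry {𝓢ₙ : ℕ → Spacetime.{u} 4}
    {pₙ : ∀ n, (𝓢ₙ n).carrier} {𝓣 : Spacetime.{v} 4} {t : 𝓣.carrier} {k : ℕ}
    {𝓢'ₙ : ℕ → Spacetime.{w} 4} (h : SubconvergesLocallyTo 𝓢ₙ pₙ 𝓣 t k)
    (Ψ : ∀ n, Diffeomorph (𝓡 4) (𝓡 4) (𝓢ₙ n).carrier (𝓢'ₙ n).carrier ∞)
    (hΨ : ∀ n, PseudoRiemannianMetric.IsIsometry (𝓢ₙ n).metric.toPseudoRiemannianMetric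
      (𝓢'ₙ n).metric.toPseudoRiemannianMetric (Ψ n))
    (hor : ∀ n, TimeOrientation.PreservesTimeOrientation (Ψ n) (𝓢ₙ n).timeOrientation
      (𝓢'ₙ n).timeOrientation) :
    SubconvergesLocallyTo 𝓢'ₙ (fun n ↦ Ψ n (pₙ n)) 𝓣 t k := by
  obtain ⟨D⟩ := h
  exact ⟨D.isometryPushforward Ψ hΨ hor⟩

end Spacetime

end Literature.Geometry.Lorentzian
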